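import Literature.IUT.LogVolume.Corollary22PrimeChoice
import HarnessLib

/-!
# [ExpEst] Corollary 5.2, proof: the choice of the prime `l` with the explicit constants —
# (P1) `h^{1/2} ≤ l ≤ 1.464δ·h^{1/2}·log(1.45δ·h)`, (P2), (P3) — PROVED from Proposition 2.2 (ii) as input

S. Mochizuki, I. Fesenko, Y. Hoshi, A. Minamide, W. Porowski, *Explicit estimates in inter-universal
Teichmüller theory*, Kodai Math. J. **45** (2022) 175–236 — [ExpEst], bib key `MochizukiEtAl2022` (D-0012
claim key, status disputed) — proof of Cor. 5.2, p. 212–214 (pdf p38.l55 – p40.l29 of the cell render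
`run/shared/lean/pub/abc-iut/plan/repair/lit/renders/MFHMP-ExplicitEstimates-Kodai2022-book-anonnd-eeiutp`):
"if we take `𝒜` to be the [finite!] set of prime numbers `p` such that `p` either (S1) is `≤ h^{1/2}`, (S2)
divides a nonzero `h_v` for some `v ∈ 𝕍(F)^non`, or (S3) is equal to `p_v` for some `v ∈ 𝕍(F)^non` for which
`h_v ≥ h^{1/2}`, then it follows from Proposition 2.2, (ii), together with our assumption that `h^{1/2} ≥
ξ_prm`, that … `θ_𝒜 ≤ 2·h^{1/2} + δ·h^{1/2} + 1.45δ·h^{1/2}·log(1.45δ·h) … ≤ 1.4621δ·h^{1/2}·log(1.45δ·h)` … we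
obtain that `1.00072·(θ_𝒜 + ξ_prm) ≤ 1.464δ·h^{1/2}·log(1.45δ·h)` … In particular, it follows from Proposition
2.2, (ii), that there exists a prime number `l` such that (P1) `(10^15·d ≤) h^{1/2} ≤ l ≤ 1.464δ·h^{1/2}·
log(1.45δ·h)`; (P2) `l` does not divide any nonzero `h_v` for `v ∈ 𝕍(F)^non`; (P3) if `l = p_v` for some `v ∈
𝕍(F)^non`, then `h_v < h^{1/2}`." CLASSICAL content (Chebyshev bookkeeping; no Θ-data occur); TAKES NO SIDE
on anything disputed.

This is the [ExpEst] twin of the tree's `Cor22.PrimeChoiceData.exists_prime_P1_P2_P3`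
(`Corollary22PrimeChoice.lean`, [IUTchIV]'s constants `10δ`, `2δ`), over the SAME abstract data
`Cor22.PrimeChoiceData` (finite set `V` of places with local heights `h_v ∈ ℕ`, residue degrees `f_v ≥ 1`,
residue characteristics `p_v`, `d = [F:ℚ] ≤ δ`, `d·h = Σ_v h_v·f_v·log(p_v)`, `ξ_prm ≤ h^{1/2}`), REUSED. The
prime-number-theorem input is [ExpEst] **Proposition 2.2 (ii)** (p. 197: "For any real number `x ≥ ξ_prm`
[= 10^15], it holds that `|θ(x) − x| ≤ 0.00071·x`", proved there from Rosser–Schoenfeld's Theorem 7) taken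
as the HYPOTHESIS `hθ` on the datum's `ξ_prm` (an explicit binder — no named fact is minted; it implies
[IUTchIV]'s `IsXiPrm`, `isXiPrm_of_theta00071`). [ExpEst]'s further standing facts enter as binders:
`552960 ≤ δ` (`δ := 2^12·3^3·5·d`, p. 211) and `10^15 ≤ h^{1/2}` ("`h^{1/2} ≥ 10^15·d`", p. 212).

PROVED: `exists_prime_not_mem_le_of_theta00071` (Prop. 2.2 (ii) "in particular": a prime `p ∉ 𝒜` with `p
≤ (1 − 0.00071)⁻¹·(θ_𝒜 + ξ_prm)`), `sum_log_hv_le_expEst` (`Σ_{h_v ≥ h^{1/2}} log(h_v) ≤ 1.45δ·h^{1/2}·log(1.45δ·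
h)` via "`1.45·log(p_v) ≥ 1.45·log(2) ≥ 1`", p. 213), `log_expEst_ge` (`log(1.45δ·h) ≥ 78` for `δ ≥ 552960`,
`h ≥ 10^30`), and the assembly `exists_prime_P1_P2_P3_expEst`. ONE DEVIATION from the printed chain, in
the kernel only: the printed intermediate constant `1.4621` ("`2 ≤ 0.0121δ·log(1.45δ·10^30) − δ`", p. 213,
which holds with a margin of `3·10⁻⁴` in the logarithm) is bypassed — the final constant `1.464` is reached
directly from `θ_𝒜 + ξ_prm ≤ (2.00071 + δ + 1.45δ·log(1.45δh))·h^{1/2}` and `log(1.45δh) ≥ 78`, which leaves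
room; the STATED (P1)–(P3) are exactly as printed.

Deliberately NOT here: (P4)–(P7), Claims 5.2A/B; Prop. 2.2 itself (Rosser–Schoenfeld numerics).
-/

noncomputable section

namespace Literature.IUT.LogVolume

open Real Finset
open scoped Nat.Prime Chebyshev

namespace ExpEst

/-! ## Summation helpers (as in `Corollary22PrimeChoice.lean`, private there) -/

/-- `Σ_{p ∈ f(s)} g(p) ≤ Σ_{x ∈ s} g(f x)` for `g ≥ 0`. [cite: MochizukiEtAl2022, Cor 5.2 proof p. 213] -/
private theorem sum_image_le_sum {ι : Type*} [DecidableEq ι] (s : Finset ι) (f : ι → ℕ) (g : ℕ → ℝ)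
    (hg : ∀ n, 0 ≤ g n) : ∑ p ∈ s.image f, g p ≤ ∑ x ∈ s, g (f x) := by
  induction s using Finset.induction_on with
  | empty => simp
  | insert a s ha ih =>
    rw [Finset.image_insert, Finset.sum_insert ha]
    by_cases hm : f a ∈ s.image f
    · rw [Finset.insert_eq_of_mem hm]; linarith [hg (f a)]
    · rw [Finset.sum_insert hm]; linarith

/-- `Σ_{p ∈ ⋃_{x∈s} t(x)} g(p) ≤ Σ_{x ∈ s} Σ_{p ∈ t(x)} g(p)` for `g ≥ 0`. [cite: MochizukiEtAl2022, Cor 5.2 proof p. 213] -/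
private theorem sum_biUnion_le_sum {ι : Type*} [DecidableEq ι] (s : Finset ι) (t : ι → Finset ℕ)
    (g : ℕ → ℝ) (hg : ∀ n, 0 ≤ g n) : ∑ p ∈ s.biUnion t, g p ≤ ∑ x ∈ s, ∑ p ∈ t x, g p := by
  induction s using Finset.induction_on with
  | empty => simp
  | insert a s ha ih =>
    rw [Finset.biUnion_insert, Finset.sum_insert ha]
    have hu : ∑ p ∈ t a ∪ s.biUnion t, g p ≤ ∑ p ∈ t a, g p + ∑ p ∈ s.biUnion t, g p := by
      rw [← Finset.sum_union_inter]
      have : 0 ≤ ∑ p ∈ t a ∩ s.biUnion t, g p := Finset.sum_nonneg fun p _ => hg p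
      linarith
    linarith

/-- `Σ_{p ∈ A ∪ B ∪ C} g ≤ Σ_A g + Σ_B g + Σ_C g` for `g ≥ 0`. [cite: MochizukiEtAl2022, Cor 5.2 proof p. 213] -/
private theorem sum_union3_le (A B C : Finset ℕ) (g : ℕ → ℝ) (hg : ∀ n, 0 ≤ g n) :
    ∑ p ∈ A ∪ B ∪ C, g p ≤ ∑ p ∈ A, g p + ∑ p ∈ B, g p + ∑ p ∈ C, g p := by
  have h1 : ∑ p ∈ A ∪ B ∪ C, g p ≤ ∑ p ∈ A ∪ B, g p + ∑ p ∈ C, g p := by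
    rw [← Finset.sum_union_inter]
    have : 0 ≤ ∑ p ∈ (A ∪ B) ∩ C, g p := Finset.sum_nonneg fun p _ => hg p
    linarith
  have h2 : ∑ p ∈ A ∪ B, g p ≤ ∑ p ∈ A, g p + ∑ p ∈ B, g p := by
    rw [← Finset.sum_union_inter]
    have : 0 ≤ ∑ p ∈ A ∩ B, g p := Finset.sum_nonneg fun p _ => hg p
    linarith
  linarith

/-- For `n ≥ 1`: `Σ_{p | n} log p ≤ log n`. [cite: MochizukiEtAl2022, Cor 5.2 proof p. 213] -/
private theorem sum_log_primeFactors_le {n : ℕ} (hn : n ≠ 0) :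
    ∑ p ∈ n.primeFactors, Real.log p ≤ Real.log n := by
  have hprod : (∏ p ∈ n.primeFactors, (p : ℝ)) = ((∏ p ∈ n.primeFactors, p : ℕ) : ℝ) := by push_cast; rfl
  rw [← Real.log_prod (s := n.primeFactors) (f := fun p : ℕ => (p : ℝ)) (fun p hp =>
    by exact_mod_cast (Nat.prime_of_mem_primeFactors hp).ne_zero), hprod]
  apply Real.log_le_log
  · exact_mod_cast Finset.prod_pos fun p hp => (Nat.prime_of_mem_primeFactors hp).pos
  · exact_mod_cast Nat.le_of_dvd (Nat.pos_of_ne_zero hn) (Nat.prod_primeFactors_dvd n)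

/-- If every prime `≤ x` lies in `A`, then `θ(x) ≤ θ_A`. [cite: MochizukiEtAl2022, Prop 2.2 (ii) p. 197] -/
private theorem theta_le_thetaSet_of_subset {A : Finset ℕ} {x : ℝ}
    (h : ∀ p : ℕ, p.Prime → (p : ℝ) ≤ x → p ∈ A) : θ x ≤ thetaSet A := by
  rw [Chebyshev.theta_eq_sum_primesLE, thetaSet]
  refine Finset.sum_le_sum_of_subset_of_nonneg (fun p hp => ?_)
    (fun p _ _ => Real.log_natCast_nonneg p)
  rw [Nat.mem_primesLE] at hp
  refine h p hp.2 ?_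
  rcases lt_or_ge x 0 with hx | hx
  · have : ⌊x⌋₊ = 0 := Nat.floor_of_nonpos hx.le
    rw [this] at hp
    exact absurd hp.2 (by have := hp.1; interval_cases p; decide)
  · exact le_trans (by exact_mod_cast hp.1) (Nat.floor_le hx)

/-! ## [ExpEst] Proposition 2.2 (ii) as an input, and its "in particular" (p. 197) -/

/-- [ExpEst] Prop. 2.2 (ii)'s bound `|θ(x) − x| ≤ 0.00071·x` (`x ≥ ξ_prm`) implies [IUTchIV] Prop. 2.1 (ii)'s
property `IsXiPrm ξ_prm` (`(2/3)x ≤ θ(x) ≤ (4/3)x`), for `ξ_prm ≥ 5` — so data carrying the [ExpEst] bound are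
`Cor22.PrimeChoiceData`. PROVED. [cite: MochizukiEtAl2022, Prop 2.2 (ii) p. 197] -/
theorem isXiPrm_of_theta00071 {ξ : ℝ} (h5 : 5 ≤ ξ)
    (hθ : ∀ x : ℝ, ξ ≤ x → |θ x - x| ≤ 0.00071 * x) : IsXiPrm ξ := by
  refine ⟨h5, fun x hx => ?_⟩
  have hx0 : 0 ≤ x := by linarith
  obtain ⟨h1, h2⟩ := abs_le.mp (hθ x hx)
  constructor <;> nlinarith

/-- **[ExpEst] Prop. 2.2 (ii), "in particular"** (p. 197): "if `𝒜` is a finite subset of 𝔓𝔯𝔦𝔪𝔢𝔰 … then there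
exists a prime number `p ∉ 𝒜` such that `p ≤ (1 − 0.00071)⁻¹·(θ_𝒜 + ξ_prm) ≤ 1.00072·(θ_𝒜 + ξ_prm)`" — PROVED from
the bound `|θ(x) − x| ≤ 0.00071·x` (`x ≥ ξ_prm > 0`): at `x := (θ_𝒜 + ξ_prm)/(1 − 0.00071) ≥ ξ_prm` one has
`θ(x) ≥ (1 − 0.00071)·x = θ_𝒜 + ξ_prm > θ_𝒜`, so not every prime `≤ x` lies in `𝒜`. (`𝒜` need not consist of
primes.) [cite: MochizukiEtAl2022, Prop 2.2 (ii) p. 197] -/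
theorem exists_prime_not_mem_le_of_theta00071 {ξ : ℝ} (hξ : 0 < ξ)
    (hθ : ∀ x : ℝ, ξ ≤ x → |θ x - x| ≤ 0.00071 * x) (A : Finset ℕ) :
    ∃ p : ℕ, p.Prime ∧ p ∉ A ∧ (p : ℝ) ≤ (thetaSet A + ξ) / (1 - 0.00071) := by
  have hA : 0 ≤ thetaSet A := Finset.sum_nonneg fun p _ => Real.log_natCast_nonneg p
  set x : ℝ := (thetaSet A + ξ) / (1 - 0.00071) with hxdef
  have hx : ξ ≤ x := by
    rw [hxdef, le_div_iff₀ (by norm_num)]; nlinarith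
  have hx0 : 0 ≤ x := by linarith
  have hlow : (1 - 0.00071) * x ≤ θ x := by
    obtain ⟨h1, -⟩ := abs_le.mp (hθ x hx); linarith
  have hprod : (1 - 0.00071) * x = thetaSet A + ξ := by
    rw [hxdef]; field_simp
  by_contra hcon
  push Not at hcon
  have hall : ∀ p : ℕ, p.Prime → (p : ℝ) ≤ x → p ∈ A := by
    intro p hp hpx
    by_contra hpA
    exact absurd (hcon p hp hpA) (not_lt.mpr hpx)
  have := theta_le_thetaSet_of_subset hall
  linarith

end ExpEst

/-! ## The (S2)-estimate with [ExpEst]'s constant `1.45`, and the size of `log(1.45δh)` -/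

namespace Cor22.PrimeChoiceData

variable (A : PrimeChoiceData)

/-- `h > 0` (from `h^{1/2} ≥ 5`). [cite: MochizukiEtAl2022, Cor 5.2 proof p. 212] -/
private theorem h_pos' : 0 < A.h := by
  have h5 := A.five_le_sqrt
  by_contra hle
  rw [not_lt] at hle
  rw [Real.sqrt_eq_zero'.mpr hle] at h5
  linarith

/-- `(√h)² = h`. [cite: MochizukiEtAl2022, Cor 5.2 proof p. 212] -/
private theorem sq_sqrt_h' : Real.sqrt A.h ^ 2 = A.h := Real.sq_sqrt A.h_pos'.le

/-- Each term of `Σ_v h_v f_v log(p_v)` is `≥ 0`. [cite: MochizukiEtAl2022, Cor 5.2 proof p. 212] -/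
private theorem term_nonneg' (v : A.ι) (_hvV : v ∈ A.V) :
    0 ≤ (A.hv v : ℝ) * (A.fv v : ℝ) * Real.log (A.pv v) := by
  have := Real.log_natCast_nonneg (A.pv v); positivity

/-- `log(1.45δh) ≥ 1` (indeed `1.45δh ≥ 1.45·2·25 ≥ e`). [cite: MochizukiEtAl2022, Cor 5.2 proof p. 213] -/
private theorem one_le_log145 : 1 ≤ Real.log (1.45 * A.δ * A.h) := by
  have hs := A.five_le_sqrt
  have hh : 25 ≤ A.h := by nlinarith [A.sq_sqrt_h']
  have h4 : (4 : ℝ) ≤ 1.45 * A.δ * A.h := by nlinarith [A.two_le_δ]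
  have he : Real.exp 1 ≤ 4 := by have := Real.exp_one_lt_d9; linarith
  calc (1 : ℝ) = Real.log (Real.exp 1) := (Real.log_exp 1).symm
    _ ≤ Real.log 4 := Real.log_le_log (Real.exp_pos 1) he
    _ ≤ Real.log (1.45 * A.δ * A.h) := Real.log_le_log (by norm_num) h4

/-- **(S2)-estimate with [ExpEst]'s constant** (p. 213 = p39): "`1.45δ·h^{1/2}·log(1.45δ·h) ≥ 1.45·[F:ℚ]·h^{1/2}·
log(1.45·[F:ℚ]·h) ≥ Σ_{h_v≠0} 1.45·h^{−1/2}·log(1.45·h_v·f_v·log(p_v))·h_v·f_v·log(p_v) ≥ Σ_{h_v≠0} h^{−1/2}·log(h_v)·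
h_v ≥ Σ_{h_v ≥ h^{1/2}} h^{−1/2}·log(h_v)·h_v ≥ Σ_{h_v ≥ h^{1/2}} log(h_v)` — where … we apply the elementary estimate
`1.45·log(p_v) ≥ 1.45·log(2) ≥ 1`": `Σ_{h_v ≥ h^{1/2}} log(h_v) ≤ 1.45δ·h^{1/2}·log(1.45δ·h)`. PROVED (the tree's
`sum_log_hv_le` with `2 ↦ 1.45`, `log 2 > 0.6931`). [cite: MochizukiEtAl2022, Cor 5.2 proof p. 213] -/
theorem sum_log_hv_le_expEst :
    ∑ v ∈ A.V.filter (fun v => Real.sqrt A.h ≤ A.hv v), Real.log (A.hv v) ≤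
      1.45 * A.δ * Real.sqrt A.h * Real.log (1.45 * A.δ * A.h) := by
  have hs := A.five_le_sqrt
  have hs0 : 0 < Real.sqrt A.h := by linarith
  have hhpos := A.h_pos'
  have hlog1 := A.one_le_log145
  set W := A.V.filter (fun v => Real.sqrt A.h ≤ A.hv v) with hW
  -- termwise: `√h · log(h_v) ≤ h_v · log(h_v) ≤ 1.45 h_v f_v log(p_v) · log(1.45 δ h)`
  have hterm : ∀ v ∈ W, Real.sqrt A.h * Real.log (A.hv v) ≤
      1.45 * ((A.hv v : ℝ) * (A.fv v : ℝ) * Real.log (A.pv v)) * Real.log (1.45 * A.δ * A.h) := by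
    intro v hv
    rw [hW, Finset.mem_filter] at hv
    obtain ⟨hvV, hge⟩ := hv
    have hhv1 : (1 : ℝ) ≤ A.hv v := by linarith
    have hlogv : 0 ≤ Real.log (A.hv v : ℝ) := Real.log_nonneg hhv1
    have hf : (1 : ℝ) ≤ A.fv v := by exact_mod_cast A.one_le_fv v hvV
    have hp2 : (2 : ℝ) ≤ A.pv v := by exact_mod_cast (A.pv_prime v hvV).two_le
    -- `1.45 log p_v ≥ 1.45 log 2 ≥ 1`
    have hlogp : 1 ≤ 1.45 * Real.log (A.pv v : ℝ) := by
      have h2 : Real.log 2 ≤ Real.log (A.pv v : ℝ) := Real.log_le_log (by norm_num) hp2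
      have := Real.log_two_gt_d9
      linarith
    have hterm_le : (A.hv v : ℝ) * (A.fv v : ℝ) * Real.log (A.pv v) ≤ (A.d : ℝ) * A.h := by
      rw [A.h_def]
      exact Finset.single_le_sum (fun w hw => A.term_nonneg' w hw) hvV
    have hvle : (A.hv v : ℝ) ≤ 1.45 * A.δ * A.h := by
      have h1 : (A.hv v : ℝ) * 1 ≤ (A.hv v : ℝ) * ((A.fv v : ℝ) * (1.45 * Real.log (A.pv v))) := by
        apply mul_le_mul_of_nonneg_left _ (by positivity); nlinarith
      have h3 := mul_le_mul_of_nonneg_right A.d_le_δ hhpos.le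
      nlinarith
    have hloghv : Real.log (A.hv v : ℝ) ≤ Real.log (1.45 * A.δ * A.h) :=
      Real.log_le_log (by linarith) hvle
    have a1 : Real.sqrt A.h * Real.log (A.hv v) ≤ (A.hv v : ℝ) * Real.log (A.hv v) :=
      mul_le_mul_of_nonneg_right hge hlogv
    have a2 : (A.hv v : ℝ) * Real.log (A.hv v) ≤ (A.hv v : ℝ) * Real.log (1.45 * A.δ * A.h) :=
      mul_le_mul_of_nonneg_left hloghv (by positivity)
    have a3 : (A.hv v : ℝ) * Real.log (1.45 * A.δ * A.h) ≤
        (A.hv v : ℝ) * ((A.fv v : ℝ) * (1.45 * Real.log (A.pv v))) * Real.log (1.45 * A.δ * A.h) := by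
      have : (A.hv v : ℝ) ≤ (A.hv v : ℝ) * ((A.fv v : ℝ) * (1.45 * Real.log (A.pv v))) := by
        have : (1 : ℝ) ≤ (A.fv v : ℝ) * (1.45 * Real.log (A.pv v)) := by nlinarith
        nlinarith
      exact mul_le_mul_of_nonneg_right this (by linarith)
    nlinarith
  have hsum : Real.sqrt A.h * ∑ v ∈ W, Real.log (A.hv v) ≤
      1.45 * (∑ v ∈ W, (A.hv v : ℝ) * (A.fv v : ℝ) * Real.log (A.pv v)) * Real.log (1.45 * A.δ * A.h) := by
    rw [Finset.mul_sum, Finset.mul_sum, Finset.sum_mul]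
    exact Finset.sum_le_sum hterm
  have hsub : ∑ v ∈ W, (A.hv v : ℝ) * (A.fv v : ℝ) * Real.log (A.pv v) ≤ (A.d : ℝ) * A.h := by
    rw [A.h_def]
    exact Finset.sum_le_sum_of_subset_of_nonneg (Finset.filter_subset _ _) fun v hv _ => A.term_nonneg' v hv
  have hd : (A.d : ℝ) * A.h ≤ A.δ * A.h := mul_le_mul_of_nonneg_right A.d_le_δ hhpos.le
  have hfinal : Real.sqrt A.h * ∑ v ∈ W, Real.log (A.hv v) ≤
      (1.45 * A.δ * Real.sqrt A.h * Real.log (1.45 * A.δ * A.h)) * Real.sqrt A.h := by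
    have : 1.45 * ((A.d : ℝ) * A.h) * Real.log (1.45 * A.δ * A.h) ≤
        1.45 * (A.δ * A.h) * Real.log (1.45 * A.δ * A.h) := by
      nlinarith
    have e : 1.45 * (A.δ * A.h) * Real.log (1.45 * A.δ * A.h) =
        (1.45 * A.δ * Real.sqrt A.h * Real.log (1.45 * A.δ * A.h)) * Real.sqrt A.h := by
      linear_combination (1.45 * A.δ * Real.log (1.45 * A.δ * A.h)) * A.sq_sqrt_h'.symm
    nlinarith [Finset.sum_nonneg (fun v (hv : v ∈ W) => A.term_nonneg' v (Finset.mem_filter.mp hv).1)]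
  rw [mul_comm] at hfinal
  exact le_of_mul_le_mul_right hfinal hs0

/-- The size of the logarithm under [ExpEst]'s standing bounds `δ ≥ 2^12·3^3·5 = 552960` (p. 211) and `h ≥
10^30` (`h^{1/2} ≥ 10^15·d`, p. 212): `log(1.45δ·h) ≥ 78` (indeed `≈ 82.67` at equality; cf. p. 213 "the function
`0.0121x·log(1.45x·10^30) − x` is monotonically increasing for `x ∈ ℝ_{≥552960}`"). PROVED via `e < 2.72` and
`2.72^78 ≤ 1.45·552960·10^30`. [cite: MochizukiEtAl2022, Cor 5.2 proof p. 213] -/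
theorem log_expEst_ge (hδ : (552960 : ℝ) ≤ A.δ) (hh : (10 : ℝ) ^ 30 ≤ A.h) :
    78 ≤ Real.log (1.45 * A.δ * A.h) := by
  have hx : (1.45 * 552960 * 10 ^ 30 : ℝ) ≤ 1.45 * A.δ * A.h := by nlinarith
  have hpos : (0 : ℝ) < 1.45 * A.δ * A.h := lt_of_lt_of_le (by norm_num) hx
  rw [Real.le_log_iff_exp_le hpos]
  have he : Real.exp 1 ≤ 2.72 := by have := Real.exp_one_lt_d9; linarith
  have he0 : 0 ≤ Real.exp 1 := (Real.exp_pos 1).le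
  have h78 : Real.exp 78 = Real.exp 1 ^ 78 := by
    rw [← Real.exp_nat_mul]; norm_num
  rw [h78]
  calc Real.exp 1 ^ 78 ≤ (2.72 : ℝ) ^ 78 := pow_le_pow_left₀ he0 he 78
    _ ≤ 1.45 * 552960 * 10 ^ 30 := by norm_num
    _ ≤ 1.45 * A.δ * A.h := hx

/-- **[ExpEst] Cor. 5.2, proof, (P1)–(P3)** (p. 213–214 = p40.l24–29): for data `A` whose `ξ_prm` carries
[ExpEst] Prop. 2.2 (ii)'s bound (`hθ`), with `δ ≥ 552960` and `h^{1/2} ≥ 10^15`, "there exists a prime number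
`l` such that (P1) `h^{1/2} ≤ l ≤ 1.464δ·h^{1/2}·log(1.45δ·h)`; (P2) `l` does not divide any nonzero `h_v`; (P3) if
`l = p_v` … then `h_v < h^{1/2}`". PROVED (assembly as in the tree's `exists_prime_P1_P2_P3`; the printed
intermediate `1.4621` is bypassed, see the module docstring). [cite: MochizukiEtAl2022, Cor 5.2 proof p. 213–214] -/
theorem exists_prime_P1_P2_P3_expEst
    (hθ : ∀ x : ℝ, A.ξ ≤ x → |θ x - x| ≤ 0.00071 * x)
    (hδ : (552960 : ℝ) ≤ A.δ) (hlarge : (10 : ℝ) ^ 15 ≤ Real.sqrt A.h) :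
    ∃ l : ℕ, l.Prime ∧ Real.sqrt A.h ≤ l ∧
      (l : ℝ) ≤ 1.464 * A.δ * Real.sqrt A.h * Real.log (1.45 * A.δ * A.h) ∧
      (∀ v ∈ A.V, A.hv v ≠ 0 → ¬ l ∣ A.hv v) ∧
      (∀ v ∈ A.V, A.pv v = l → (A.hv v : ℝ) < Real.sqrt A.h) := by
  have hs := A.five_le_sqrt
  have hs0 : 0 < Real.sqrt A.h := by linarith
  have hξ0 : 0 < A.ξ := by linarith [A.isXiPrm.1]
  have hh : (10 : ℝ) ^ 30 ≤ A.h := by nlinarith [A.sq_sqrt_h']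
  have hlog := A.log_expEst_ge hδ hh
  -- the set `𝒜` of excluded primes: (S1) ∪ (S2′) ∪ (S3), with (S2′) = prime factors of the `h_v ≥ √h`
  set W := A.V.filter (fun v => Real.sqrt A.h ≤ A.hv v) with hW
  set S1 : Finset ℕ := Nat.primesLE ⌊Real.sqrt A.h⌋₊ with hS1
  set S2 : Finset ℕ := W.biUnion (fun v => (A.hv v).primeFactors) with hS2
  set S3 : Finset ℕ := W.image A.pv with hS3
  obtain ⟨l, hlp, hlA, hlle⟩ := ExpEst.exists_prime_not_mem_le_of_theta00071 hξ0 hθ (S1 ∪ S2 ∪ S3)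
  have hl1 : l ∉ S1 := fun h => hlA (Finset.mem_union_left _ (Finset.mem_union_left _ h))
  have hl2 : l ∉ S2 := fun h => hlA (Finset.mem_union_left _ (Finset.mem_union_right _ h))
  have hl3 : l ∉ S3 := fun h => hlA (Finset.mem_union_right _ h)
  -- (P1), lower bound: `l ∉ (S1)` means `l > ⌊√h⌋`, so `l > √h`
  have hP1lo : Real.sqrt A.h ≤ l := by
    have : ¬ (l ≤ ⌊Real.sqrt A.h⌋₊) := fun h => hl1 (by rw [hS1, Nat.mem_primesLE]; exact ⟨h, hlp⟩)
    have hlt : ⌊Real.sqrt A.h⌋₊ < l := by omega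
    exact (Nat.lt_of_floor_lt hlt).le
  -- (P3)
  have hP3 : ∀ v ∈ A.V, A.pv v = l → (A.hv v : ℝ) < Real.sqrt A.h := by
    intro v hvV hpl
    by_contra hge
    rw [not_lt] at hge
    exact hl3 (by rw [hS3, Finset.mem_image]; exact ⟨v, by rw [hW, Finset.mem_filter]; exact ⟨hvV, hge⟩, hpl⟩)
  -- (P2)
  have hP2 : ∀ v ∈ A.V, A.hv v ≠ 0 → ¬ l ∣ A.hv v := by
    intro v hvV hne hdvd
    rcases le_or_gt (Real.sqrt A.h) (A.hv v) with hge | hlt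
    · exact hl2 (by
        rw [hS2, Finset.mem_biUnion]
        exact ⟨v, by rw [hW, Finset.mem_filter]; exact ⟨hvV, hge⟩,
          Nat.mem_primeFactors.mpr ⟨hlp, hdvd, hne⟩⟩)
    · have hle : (l : ℝ) ≤ A.hv v := by exact_mod_cast Nat.le_of_dvd (Nat.pos_of_ne_zero hne) hdvd
      linarith
  -- (P1), upper bound: `θ_𝒜 ≤ 1.00071·√h + 1.45δ√h·log(1.45δh) + δ√h`
  have hθA : thetaSet (S1 ∪ S2 ∪ S3) ≤
      1.00071 * Real.sqrt A.h + 1.45 * A.δ * Real.sqrt A.h * Real.log (1.45 * A.δ * A.h)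
        + A.δ * Real.sqrt A.h := by
    have hsplit := ExpEst.sum_union3_le S1 S2 S3 (fun p => Real.log p) (fun n => Real.log_natCast_nonneg n)
    -- (S1): `θ(√h) ≤ (1 + 0.00071)√h`
    have h1 : ∑ p ∈ S1, Real.log (p : ℝ) ≤ 1.00071 * Real.sqrt A.h := by
      have hθ1 : θ (Real.sqrt A.h) = ∑ p ∈ S1, Real.log (p : ℝ) := by
        rw [Chebyshev.theta_eq_sum_primesLE]
      obtain ⟨-, h2⟩ := abs_le.mp (hθ (Real.sqrt A.h) A.ξ_le_sqrt)
      rw [hθ1] at h2; linarith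
    -- (S2′): `Σ ≤ Σ_{h_v ≥ √h} log h_v ≤ 1.45δ√h log(1.45δh)`
    have h2 : ∑ p ∈ S2, Real.log (p : ℝ) ≤ 1.45 * A.δ * Real.sqrt A.h * Real.log (1.45 * A.δ * A.h) := by
      refine le_trans (ExpEst.sum_biUnion_le_sum W _ _ (fun n => Real.log_natCast_nonneg n)) ?_
      refine le_trans (Finset.sum_le_sum fun v hv => ?_) A.sum_log_hv_le_expEst
      have hv' : Real.sqrt A.h ≤ A.hv v := (Finset.mem_filter.mp hv).2
      exact ExpEst.sum_log_primeFactors_le (by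
        intro h0; rw [h0] at hv'; push_cast at hv'; linarith)
    -- (S3): `Σ ≤ Σ_{h_v ≥ √h} log p_v ≤ δ√h`
    have h3 : ∑ p ∈ S3, Real.log (p : ℝ) ≤ A.δ * Real.sqrt A.h :=
      le_trans (ExpEst.sum_image_le_sum W A.pv _ (fun n => Real.log_natCast_nonneg n)) A.sum_log_pv_le
    unfold thetaSet
    linarith
  have hξs : A.ξ ≤ Real.sqrt A.h := A.ξ_le_sqrt
  -- numeric core: `(θ_𝒜 + ξ)/(1 − 0.00071) ≤ 1.464·δ·√h·log(1.45δh)` from `log(1.45δh) ≥ 78`, `δ ≥ 552960`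
  have hP1hi : (l : ℝ) ≤ 1.464 * A.δ * Real.sqrt A.h * Real.log (1.45 * A.δ * A.h) := by
    refine le_trans hlle ?_
    rw [div_le_iff₀ (by norm_num)]
    set L := Real.log (1.45 * A.δ * A.h) with hL
    set s := Real.sqrt A.h with hsd
    -- `θ_𝒜 + ξ ≤ (2.00071 + δ + 1.45 δ L)·s` and `2.00071 + δ ≤ (1.464·0.99929 − 1.45)·δ·L`
    have hsum : thetaSet (S1 ∪ S2 ∪ S3) + A.ξ ≤ (2.00071 + A.δ + 1.45 * A.δ * L) * s := by nlinarith
    have hcoef : 2.00071 + A.δ + 1.45 * A.δ * L ≤ 1.464 * A.δ * L * (1 - 0.00071) := by nlinarith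
    calc thetaSet (S1 ∪ S2 ∪ S3) + A.ξ ≤ (2.00071 + A.δ + 1.45 * A.δ * L) * s := hsum
      _ ≤ (1.464 * A.δ * L * (1 - 0.00071)) * s := mul_le_mul_of_nonneg_right hcoef hs0.le
      _ = 1.464 * A.δ * s * L * (1 - 0.00071) := by ring
  exact ⟨l, hlp, hP1lo, hP1hi, hP2, hP3⟩

end Cor22.PrimeChoiceData

end Literature.IUT.LogVolume

end
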